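import Summits.QuantumFields.YangMills.Theorems.UnitScaleTiltFluctuationComparisonRegPrGlobalSlackCanonicalPolymersVolume
import Summits.QuantumFields.Balaban3D.Proofs.TorusLift
import HarnessLib

/-!
# `UnitScaleTiltFluctuationComparisonRegPrGlobalSlackCanonicalPolymersMatched` — THE TWO-RUN GEOMETRY ROW `LocMatched` FOR THE CANONICAL POLYMERISATION OF A v3 FAMILY
# (crux `FluctuationComparisonRegPrL`, stmt-QuantumFields-19935, STUB 3⁗ `stub_globalTwoRunSlackFam`; width-lever lane A, the producer's fourth row)

Seat ym-ust-19935-slack g0 (prover).  `T3AlphaInputsACTwoRunLevel.LocMatched D` — «the refinement map `refineSet F K` ([Balaban1987RG1] (0.1): a point set of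
run `K`'s finest torus read one cut-off finer) is a BIJECTION from the level-`i` localisation domains of run `K` at lattice level `K − n` onto the level-`(i+1)`
domains of run `K+1` at lattice level `K + 1 − n` (trivial histories)» — DISCHARGED for `D := dataOfV3 p (canonPolymer p)` of ANY v3 family `p`.  The point:
the retained-domain finset `StepSeries.loc` reads only the GEOMETRY (`Ωblk`, the retained radius `R₁ r(g_k)` and the tree length), not the step data, so the
canonical `Loc` of run `K+1` one level up is the canonical `Loc` of run `K` transported along the level identification `siteShift` of [Balaban1987RG1] (0.1)
(`S_k(K) = S_{k+1}(K+1)`, `g_k(K) = g_{k+1}(K+1)`):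

* §1 the level identification `liftSite F K i : (F.P K)_i ≃ (F.P (K+1))_{i+1}` and its labels; `val_coarsenSite`; **`coarsen_succ_eq_liftSite`** (the `(i+1)`-fold
  block map of run `K+1` = `liftSite ∘` the `i`-fold block map of run `K` `∘ coarsenSite`), `bigBlockOf_succ_eq`; `refineSet_injective`;
* §2 blocks: `refineSet_blockSet`, `mem_oldBlocks_triv_iff`, `isCorner_liftSite_iff`;
* §3 domains: `dom_eq`/`domCast` (transport of `tsys`-domains along `N = N'`), `refineSet_domSet`, `nblkOf_succ_eq`, `gk_succ_eq`, `rretOf_succ_eq`, `mem_newDoms_triv_iff`;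
* §4 **`locMatched_canon : LocMatched (dataOfV3 p (canonPolymer p))`** — the producer's FOURTH row, discharged (old levels block by block, the new level domain by
  domain; injectivity because `coarsenSite` is onto).
Pure lattice bookkeeping; nothing of [Balaban1985UV3] is asserted.

References: T. Bałaban, CMP 109 (1987) 249–301 [Balaban1987RG1] ((0.1)–(0.4) pp.251–253); CMP 102 (1985) 255–275 [Balaban1985UV3] ((39) p.266, (43) p.266, (59) p.270).
-/

set_option autoImplicit false

noncomputable section

namespace Summit.QuantumFields.YangMills.Theorems.GlobalSlackCanonicalPolymers

open scoped BigOperators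
open Finset
open Literature.MathematicalPhysics.QuantumFieldTheory.Balaban1983to89
open Literature.MathematicalPhysics.QuantumFieldTheory.Balaban1983to89.T3ContinuumYM3Torus
open Literature.MathematicalPhysics.QuantumFieldTheory.Balaban1983to89.T3LevelShift
open Literature.MathematicalPhysics.QuantumFieldTheory.Balaban1983to89.T3AlphaPolymerSocket
open Literature.MathematicalPhysics.QuantumFieldTheory.Balaban1983to89.T3AlphaInputsAC
open Literature.MathematicalPhysics.QuantumFieldTheory.Balaban1983to89.T3AlphaInputsACTwoRunLevel
open Literature.MathematicalPhysics.QuantumFieldTheory.Balaban1983to89.TreeLengthTorus (tsys TPt)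
open Literature.MathematicalPhysics.QuantumFieldTheory.Balaban1985CMP102
open Literature.MathematicalPhysics.QuantumFieldTheory.Balaban1985CMP102.Setting
open Summit.QuantumFields.Balaban3D.Carriers
open Summit.QuantumFields.Balaban3D.Proofs.Primitives
open Summit.QuantumFields.Balaban3D.Proofs.TorusLift (val_coarsen)
open Summit.QuantumFields.YangMills.Theorems

variable {F : T3Family}

/-! ## §1 The level identification `i ↦ i + 1` between run `K` and run `K + 1` -/

/-- **THE LEVEL IDENTIFICATION** `(F.P K)_i ≃ (F.P (K+1))_{i+1}` (equal moduli `2L^{m+K−i}`), coordinate by coordinate. [cite: Balaban1987RG1, (0.1) p.251] -/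
def liftSite (F : T3Family) (K i : ℕ) : Site (F.P K) i ≃ Site (F.P (K + 1)) (i + 1) :=
  siteShift (F.sitesPerDir_eq (m := F.m) (K := K) (j := i) (m' := F.m) (K' := K + 1) (j' := i + 1) (by omega))

/-- `liftSite` preserves labels. [cite: Balaban1987RG1, (0.1) p.251] -/
theorem val_liftSite (K i : ℕ) (y : Site (F.P K) i) (ν : Fin 3) : ((liftSite F K i y) ν).val = (y ν).val :=
  coordEquiv_val _ (y ν)

/-- `liftSite.symm` preserves labels. [cite: Balaban1987RG1, (0.1) p.251] -/
theorem val_liftSite_symm (K i : ℕ) (y' : Site (F.P (K + 1)) (i + 1)) (ν : Fin 3) : (((liftSite F K i).symm y') ν).val = (y' ν).val := by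
  conv_rhs => rw [← (liftSite F K i).apply_symm_apply y']
  rw [val_liftSite]

/-- The labels of `coarsenSite x'` are `label(x') / L`. [cite: Balaban1987RG1, (0.1) p.251] -/
theorem val_coarsenSite (K : ℕ) (x' : Site (F.P (K + 1)) 0) (ν : Fin 3) : ((coarsenSite F K x') ν).val = (x' ν).val / F.L := by
  have e : liftSite F K 0 (coarsenSite F K x') = blockOf x' := (liftSite F K 0).apply_symm_apply (blockOf x')
  have h1 : ((liftSite F K 0 (coarsenSite F K x')) ν).val = ((blockOf x') ν).val := by rw [e]
  rw [val_liftSite] at h1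
  rw [h1, Site.val_blockOf (show 0 + 1 ≤ (F.P (K + 1)).m + (F.P (K + 1)).K by have := F.hm; show 0 + 1 ≤ F.m + (K + 1); omega) x' ν]
  rfl

/-- **THE `(i+1)`-FOLD BLOCK MAP OF RUN `K+1` IS THE `i`-FOLD BLOCK MAP OF RUN `K` AFTER `coarsenSite`**, along `liftSite` (`i ≤ m + K`; labels
`n / L^{i+1} = (n / L) / L^i`). [cite: Balaban1987RG1, (0.3) p.252] -/
theorem coarsen_succ_eq_liftSite (K i : ℕ) (hi : i ≤ F.m + K) (x' : Site (F.P (K + 1)) 0) :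
    coarsen (i + 1) x' = liftSite F K i (coarsen i (coarsenSite F K x')) := by
  funext ν
  apply ZMod.val_injective
  rw [val_liftSite, val_coarsen (P := F.P (K + 1)) (i + 1) (show i + 1 ≤ F.m + (K + 1) by omega) x' ν,
    val_coarsen (P := F.P K) i (show i ≤ F.m + K from hi) _ ν, val_coarsenSite, Nat.div_div_eq_div_mul, pow_succ']
  rfl

/-- The scale-`(i+1)` big-block label of run `K+1` is the scale-`i` big-block label of run `K` after `coarsenSite` (`i ≤ m + K`). [cite: Balaban1985UV3, (39) p.266] -/
theorem bigBlockOf_succ_eq (M₁ K i : ℕ) (hi : i ≤ F.m + K) (x' : Site (F.P (K + 1)) 0) :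
    bigBlockOf M₁ (i + 1) x' = bigBlockOf M₁ i (coarsenSite F K x') := by
  funext ν
  show ((coarsen (i + 1) x') ν).val / M₁ = ((coarsen i (coarsenSite F K x')) ν).val / M₁
  rw [coarsen_succ_eq_liftSite K i hi x', val_liftSite]

/-- `coarsenSite` is onto (the block map is). [cite: Balaban1987RG1, (0.1) p.251] -/
theorem coarsenSite_surjective (K : ℕ) : Function.Surjective (coarsenSite F K) := by
  intro x
  obtain ⟨x', hx'⟩ := coarsen_surjective (P := F.P (K + 1)) 1 (show 1 ≤ F.m + (K + 1) by omega) (liftSite F K 0 x)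
  refine ⟨x', ?_⟩
  show (liftSite F K 0).symm (blockOf x') = x
  rw [Equiv.symm_apply_eq]
  exact hx'

/-- **`refineSet` IS INJECTIVE** (preimage under a surjection). [cite: Balaban1987RG1, (0.1) p.251] -/
theorem refineSet_injective (K : ℕ) : Function.Injective (refineSet F K) :=
  fun _ _ h => (Set.preimage_injective.mpr (coarsenSite_surjective K)) h

/-! ## §2 Blocks across the two runs -/

/-- **A BLOCK REFINES TO THE BLOCK ONE LEVEL UP**: `refineSet (blockSet K i y) = blockSet (K+1) (i+1) (liftSite y)` (`i ≤ m + K`). [cite: Balaban1987RG1, (0.1) p.251] -/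
theorem refineSet_blockSet (K i : ℕ) (hi : i ≤ F.m + K) (y : Site (F.P K) i) :
    refineSet F K (blockSet K i y) = blockSet (K + 1) (i + 1) (liftSite F K i y) := by
  ext x'
  rw [mem_refineSet_iff]
  show coarsen i (coarsenSite F K x') = y ↔ coarsen (i + 1) x' = liftSite F K i y
  rw [coarsen_succ_eq_liftSite K i hi x']
  exact (liftSite F K i).injective.eq_iff.symm

/-- At the trivial history the old blocks of level `j` are exactly the big-block corners (`Ω = T`). [cite: Balaban1985UV3, (43) p.266] -/
theorem mem_oldBlocks_triv_iff {P : Params} (M₁ : ℕ) (Rcol : ℕ → ℕ) (k j : ℕ) (y : Site P j) :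
    y ∈ oldBlocks M₁ Rcol (Hist.triv P (k + 1)) j ↔ IsCorner M₁ y := by
  rw [mem_oldBlocks, Hist.proj_triv, Omega_triv, bigIn_univ]
  simp

/-- Corners correspond under `liftSite` (same labels). [cite: Balaban1985UV3, (43) p.266] -/
theorem isCorner_liftSite_iff (M₁ K i : ℕ) (y : Site (F.P K) i) : IsCorner M₁ (liftSite F K i y) ↔ IsCorner M₁ y := by
  show (∀ μ : Fin 3, M₁ ∣ ((liftSite F K i y) μ).val) ↔ ∀ μ : Fin 3, M₁ ∣ (y μ).val
  simp only [val_liftSite]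

/-! ## §3 Domains across the two runs -/

/-- The `tsys`-domain types along `N = N'`. [folklore] -/
theorem dom_eq {N N' : ℕ} [NeZero N] [NeZero N'] (h : N = N') : (tsys 3 N).Dom = (tsys 3 N').Dom := by
  subst h; rfl

/-- Transport of a `tsys`-domain along `N = N'`. [folklore] -/
def domCast {N N' : ℕ} [NeZero N] [NeZero N'] (h : N = N') (X : (tsys 3 N).Dom) : (tsys 3 N').Dom :=
  cast (dom_eq h) X

/-- The blocks of a transported domain have the same labels. [folklore] -/
theorem exists_mem_domCast_iff {N N' : ℕ} [NeZero N] [NeZero N'] (h : N = N') (X : (tsys 3 N).Dom) (v : Fin 3 → ℕ) :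
    (∃ b ∈ (domCast h X).1, v = fun μ => ((b : Fin 3 → ZMod N') μ).val) ↔ ∃ b ∈ X.1, v = fun μ => ((b : Fin 3 → ZMod N) μ).val := by
  subst h; exact Iff.rfl

/-- Transport preserves the tree length. [folklore] -/
theorem dj_domCast {N N' : ℕ} [NeZero N] [NeZero N'] (h : N = N') (X : (tsys 3 N).Dom) : (tsys 3 N').dj (domCast h X) = (tsys 3 N).dj X := by
  subst h; rfl

/-- Transport there and back. [folklore] -/
theorem domCast_domCast {N N' : ℕ} [NeZero N] [NeZero N'] (h : N = N') (X' : (tsys 3 N').Dom) : domCast h (domCast h.symm X') = X' := by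
  subst h; rfl

/-- **A DOMAIN'S POINT SET REFINES TO THE TRANSPORTED DOMAIN'S POINT SET ONE SCALE UP**: `refineSet (domSet M₁ K k X) = domSet M₁ (K+1) (k+1) (domCast h X)`
(`k ≤ m + K`). [cite: Balaban1985UV3, (59) p.270] -/
theorem refineSet_domSet {N N' : ℕ} [NeZero N] [NeZero N'] (h : N = N') (M₁ K k : ℕ) (hk : k ≤ F.m + K) (X : (tsys 3 N).Dom) :
    refineSet F K (domSet (F := F) M₁ K k X) = domSet (F := F) M₁ (K + 1) (k + 1) (domCast h X) := by
  subst h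
  ext x'
  rw [mem_refineSet_iff]
  show (∃ b ∈ X.1, bigBlockOf M₁ k (coarsenSite F K x') = fun μ => ((b : Fin 3 → ZMod N) μ).val) ↔
    ∃ b ∈ X.1, bigBlockOf M₁ (k + 1) x' = fun μ => ((b : Fin 3 → ZMod N) μ).val
  rw [bigBlockOf_succ_eq M₁ K k hk x']
  exact Iff.rfl

variable {𝔠 : AlphaConsts F.L (suGroupModel 2).N} {γ : ℝ} {hγ : 0 < γ} {hγ1 : γ ≤ (min 𝔠.gamma0 1) ^ 2}

/-- `S_k(K) = S_{k+1}(K+1)`, hence the same number of big blocks per direction. [cite: Balaban1985UV3, (39) p.266] -/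
theorem nblkOf_succ_eq (K k : ℕ) : nblkOf (SK F 𝔠 γ hγ hγ1 K) 𝔠.lane.carrier k = nblkOf (SK F 𝔠 γ hγ hγ1 (K + 1)) 𝔠.lane.carrier (k + 1) := by
  rw [nblkOf_SK, nblkOf_SK, show (F.P K).sitesPerDir k = (F.P (K + 1)).sitesPerDir (k + 1) from
    F.sitesPerDir_eq (m := F.m) (K := K) (j := k) (m' := F.m) (K' := K + 1) (j' := k + 1) (by omega)]

/-- `g_k(K) = g_{k+1}(K+1)` (`= √(γ L^{−(K−k)})`, `k ≤ K`). [cite: Balaban1985UV3, (3) p.256] -/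
theorem gk_succ_eq (K k : ℕ) (hk : k ≤ K) : (SK F 𝔠 γ hγ hγ1 (K + 1)).gk (k + 1) = (SK F 𝔠 γ hγ hγ1 K).gk k := by
  rw [SK, SK, T3Scales_gk_eq F γ hγ _ (K + 1) (k + 1) (by omega), T3Scales_gk_eq F γ hγ _ K k hk, Nat.add_sub_add_right]

/-- The retained radius `R₁ r(g_k)` agrees. [cite: Balaban1985UV3, (59) p.270] -/
theorem rretOf_succ_eq (K k : ℕ) (hk : k ≤ K) :
    rretOf (SK F 𝔠 γ hγ hγ1 (K + 1)) 𝔠.lane.carrier (k + 1) = rretOf (SK F 𝔠 γ hγ hγ1 K) 𝔠.lane.carrier k := by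
  rw [rretOf, rretOf, gk_succ_eq K k hk]

variable (p : ∀ K, AlphaInputsT3AC.PkgAtV3 F 𝔠 γ hγ hγ1 K)

/-- At the trivial history a domain is retained iff its tree length is below the retained radius (`Ωblk = univ`). [cite: Balaban1985UV3, (59) p.270] -/
theorem mem_newDoms_triv_iff (K k : ℕ) (X : (tsys 3 (nblkOf (SK F 𝔠 γ hγ hγ1 K) 𝔠.lane.carrier k)).Dom) :
    X ∈ newDoms p K k (Hist.triv (F.P K) (k + 1)) ↔
      (tsys 3 (nblkOf (SK F 𝔠 γ hγ hγ1 K) 𝔠.lane.carrier k)).dj X < rretOf (SK F 𝔠 γ hγ hγ1 K) 𝔠.lane.carrier k := by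
  have hΩ : ∀ b, b ∈ ΩblkOf 𝔠.lane.carrier.M₁ (rcolOf (SK F 𝔠 γ hγ hγ1 K) 𝔠.lane.carrier) (nblkOf (SK F 𝔠 γ hγ hγ1 K) 𝔠.lane.carrier k)
      (Hist.triv (SK F 𝔠 γ hγ hγ1 K).P (k + 1)) := fun b => by
    rw [ΩblkOf_triv]; exact Finset.mem_univ b
  simp only [newDoms, StepSeries.loc, Finset.mem_filter, Finset.mem_univ, true_and]
  exact ⟨fun h => h.2, fun h => ⟨fun b _ => hΩ b, h⟩⟩

/-! ## §4 The row `LocMatched` -/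

/-- **PRODUCER ROW 4 FOR THE CANONICAL POLYMERISATION: `LocMatched (dataOfV3 p (canonPolymer p))`** — for `n ≤ K`, `1 ≤ i ≤ K − n`, `refineSet F K` is a bijection
from `canonLoc p K (K−n) triv i` onto `canonLoc p (K+1) (K+1−n) triv (i+1)`: the old blocks (`i ≤ K − n − 1`) go to the old blocks one level up (`refineSet_blockSet`,
corners to corners), the new domains (`i = K − n`) to the transported new domains (`refineSet_domSet`; same tree length, same retained radius); injective because
`coarsenSite` is onto. [cite: Balaban1987RG1, (0.1) p.251] -/
theorem locMatched_canon : LocMatched (AlphaInputsT3AC.dataOfV3 p (canonPolymer p)) := by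
  classical
  intro K n hn i hi1 hi2
  change Set.BijOn (refineSet F K) ↑(canonLoc p K (K - n) (Hist.triv (F.P K) (K - n)) i)
    ↑(canonLoc p (K + 1) (K + 1 - n) (Hist.triv (F.P (K + 1)) (K + 1 - n)) (i + 1))
  obtain ⟨k, hk⟩ : ∃ k, K - n = k + 1 := ⟨K - n - 1, by omega⟩
  have hk' : K + 1 - n = k + 1 + 1 := by omega
  rw [hk, hk']
  have hkK : k + 1 ≤ K := by omega
  have hkK' : k + 1 + 1 ≤ K + 1 := by omega
  have hkm : k ≤ F.m + K := by omega
  have hinj : Set.InjOn (refineSet F K) ↑(canonLoc p K (k + 1) (Hist.triv (F.P K) (k + 1)) i) := (refineSet_injective K).injOn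
  by_cases hik : i = k + 1
  · -- the NEW level: domains to transported domains
    subst hik
    have hN := nblkOf_succ_eq (F := F) (𝔠 := 𝔠) (γ := γ) (hγ := hγ) (hγ1 := hγ1) K k
    have hL : (canonLoc p K (k + 1) (Hist.triv (F.P K) (k + 1)) (k + 1) : Set (Set (Site (F.P K) 0))) =
        domSet (F := F) 𝔠.lane.carrier.M₁ K k ''
          ((newDoms p K k (Hist.triv (F.P K) (k + 1)) : Finset (tsys 3 (nblkOf (SK F 𝔠 γ hγ hγ1 K) 𝔠.lane.carrier k)).Dom) :
            Set (tsys 3 (nblkOf (SK F 𝔠 γ hγ hγ1 K) 𝔠.lane.carrier k)).Dom) := by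
      simp only [canonLoc, if_pos hkK, ite_true, coe_image]
    have hR : (canonLoc p (K + 1) (k + 1 + 1) (Hist.triv (F.P (K + 1)) (k + 1 + 1)) (k + 1 + 1) : Set (Set (Site (F.P (K + 1)) 0))) =
        domSet (F := F) 𝔠.lane.carrier.M₁ (K + 1) (k + 1) ''
          ((newDoms p (K + 1) (k + 1) (Hist.triv (F.P (K + 1)) (k + 1 + 1)) :
              Finset (tsys 3 (nblkOf (SK F 𝔠 γ hγ hγ1 (K + 1)) 𝔠.lane.carrier (k + 1))).Dom) :
            Set (tsys 3 (nblkOf (SK F 𝔠 γ hγ hγ1 (K + 1)) 𝔠.lane.carrier (k + 1))).Dom) := by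
      simp only [canonLoc, if_pos hkK', ite_true, coe_image]
    rw [hL] at hinj
    rw [hL, hR]
    refine Set.BijOn.mk ?_ hinj ?_
    · rintro _ ⟨X, hX, rfl⟩
      refine ⟨domCast hN X, ?_, (refineSet_domSet hN _ K k hkm X).symm⟩
      rw [Finset.mem_coe, mem_newDoms_triv_iff] at hX ⊢
      rw [dj_domCast, rretOf_succ_eq K k (by omega)]
      exact hX
    · rintro _ ⟨X', hX', rfl⟩
      refine ⟨domSet (F := F) 𝔠.lane.carrier.M₁ K k (domCast hN.symm X'), ⟨domCast hN.symm X', ?_, rfl⟩, ?_⟩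
      · rw [Finset.mem_coe, mem_newDoms_triv_iff] at hX' ⊢
        rw [dj_domCast, ← rretOf_succ_eq K k (by omega)]
        exact hX'
      · rw [refineSet_domSet hN _ K k hkm, domCast_domCast]
  · -- an OLD level: blocks to blocks
    have hi : i ∈ Finset.Icc 1 k := Finset.mem_Icc.mpr ⟨hi1, by omega⟩
    have hi' : i + 1 ∈ Finset.Icc 1 (k + 1) := Finset.mem_Icc.mpr ⟨by omega, by omega⟩
    have hik' : ¬ (i + 1 = k + 1 + 1) := by omega
    have him : i ≤ F.m + K := by omega
    have hL : (canonLoc p K (k + 1) (Hist.triv (F.P K) (k + 1)) i : Set (Set (Site (F.P K) 0))) =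
        blockSet K i '' ↑(oldBlocks 𝔠.lane.carrier.M₁ (rcolOf (SK F 𝔠 γ hγ hγ1 K) 𝔠.lane.carrier) (Hist.triv (F.P K) (k + 1)) i) := by
      simp only [canonLoc, if_pos hkK, if_neg hik, if_pos hi, coe_image]
    have hR : (canonLoc p (K + 1) (k + 1 + 1) (Hist.triv (F.P (K + 1)) (k + 1 + 1)) (i + 1) : Set (Set (Site (F.P (K + 1)) 0))) =
        blockSet (K + 1) (i + 1) ''
          ↑(oldBlocks 𝔠.lane.carrier.M₁ (rcolOf (SK F 𝔠 γ hγ hγ1 (K + 1)) 𝔠.lane.carrier) (Hist.triv (F.P (K + 1)) (k + 1 + 1)) (i + 1)) := by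
      simp only [canonLoc, if_pos hkK', if_neg hik', if_pos hi', coe_image]
    rw [hL] at hinj
    rw [hL, hR]
    refine Set.BijOn.mk ?_ hinj ?_
    · rintro _ ⟨y, hy, rfl⟩
      refine ⟨liftSite F K i y, ?_, (refineSet_blockSet K i him y).symm⟩
      rw [Finset.mem_coe, mem_oldBlocks_triv_iff] at hy ⊢
      exact (isCorner_liftSite_iff _ K i y).mpr hy
    · rintro _ ⟨y', hy', rfl⟩
      refine ⟨blockSet K i ((liftSite F K i).symm y'), ⟨(liftSite F K i).symm y', ?_, rfl⟩, ?_⟩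
      · rw [Finset.mem_coe, mem_oldBlocks_triv_iff] at hy' ⊢
        rw [← isCorner_liftSite_iff _ K i, Equiv.apply_symm_apply]
        exact hy'
      · rw [refineSet_blockSet K i him, Equiv.apply_symm_apply]

end Summit.QuantumFields.YangMills.Theorems.GlobalSlackCanonicalPolymers

end
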